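import Mathlib.NumberTheory.LSeries.DirichletContinuation
import Mathlib.NumberTheory.NumberField.ClassNumber
import Mathlib.NumberTheory.NumberField.Discriminant.Defs
import Literature.NumberTheory.QuadraticFields.BinaryQuadraticFormsClassNumber
import Literature.NumberTheory.QuadraticFields.ReducedForms
import HarnessLib

/-!
# Siegel's zero as an arithmetic mean: `1 − β = (6/π²)·L(1,χ)/Σ' 1/a · (1 + o(1))`, the per-class
# bound on `Σ 1/|a|`, and `1 − β ≥ (6/π − η)/√|d|`, `(6/π² − η) log d/√d`
# (Goldfeld–Schinzel 1975; Goldfeld 1975) — AS PRINTED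

Topic `Literature/NumberTheory/LFunctions` (namespace `Literature.NumberTheory.LFunctions`; the
papers' auxiliary objects in the sub-namespaces `GoldfeldSchinzel1975` and `Goldfeld1975`).
STATEMENT LAYER (D-0014) typed for the cell `parity-realchar` (SIEGEL INSTRUMENT, conditionals column
topic I.1 «class numbers»: the "several, quite precise relations between `β_χ`, `h` and `L(1,χ)`,
see [GSc], [G1]" that Iwaniec's survey points to and that `SiegelZeroClassNumberBound.lean` records
as "none of which is held" — now held and read; and the `1 − β ≥ c/√d` comparator line of TARGET §2
row 14) and cc `landau-siegel` (§C). Sources, both read first-hand from the Numdam scans rendered page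
by page (2026-08-27):

* [GoldfeldSchinzel1975] D. M. Goldfeld, A. Schinzel, *On Siegel's zero*, Ann. Scuola Norm. Sup.
  Pisa Cl. Sci. (4) **2** (1975) 571–583 (corpus key `paper:url-722e65be33a1`): Theorem 1 and
  Theorem 2 p. 571–572, Corollary p. 572, Lemma 1 p. 572, proof of the Corollary p. 582–583.
* [Goldfeld1975SiegelZeroClassNumber] D. M. Goldfeld, *An asymptotic formula relating the Siegel zero
  and the class number of quadratic fields*, ibid. 611–615 (corpus key `paper:url-62347b8a194f`):
  §1 and Theorem 1 p. 611–612 (Theorem 2, `d > 0`, index only).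

## What the sources print (verbatim)

[GoldfeldSchinzel1975] p. 571: "Let `d` be fundamental discriminant, and let `χ(n) = (d/n)`
(Kronecker's symbol). It is well known (see [1]) that `L(s, χ)` has at most one zero `β` in the
interval `(1 − c₁/log|d|, 1)` where `c₁` is an absolute positive constant. [...]
**THEOREM 1.** Let `d`, `χ` and `β` have the meaning defined above. Then the following asymptotic
relation holds
(1) `1 − β = (6/π²) (L(1,χ)/Σ' 1/a) [1 + O((log log|d|)²/log|d|) + O((1 − β) log|d|)]`
where `Σ'` is taken over all quadratic forms `(a, b, c)` of discriminant `d` such that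
(2) `−a < b ≤ a < ¼√|d|`, and the constants in the `O`-symbols are effectively computable.
**THEOREM 2.** If `(a, b, c)` runs through a class `C` of properly equivalent primitive forms of
discriminant `d`, supposed fundamental, then `Σ_{(a,b,c) ∈ C, ¼√|d| ≥ |a| ≥ b > −|a|} 1/|a| ≤ 1/m₀`
if `d < 0`, `≤ log ε₀/log(½√d − 1) + 4/√d` if `d > 676`, where `m₀` is the least positive integer
represented by `C` and `ε₀` is the least totally positive unit of the field `Q(√d)`."
p. 572: "Theorems 1 and 2 together imply **COROLLARY.** For any `η > 0` and `|d| > c(η)`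
(`d` fundamental) we have `1 − β ≥ (6/π − η)(1/√|d|)` if `d < 0`, `1 − β ≥ (6/π² − η)(log d/√d)` if
`d > 0`, where `c(η)` is an effectively computable constant." "**LEMMA 1.** Let
`f(d) = (log|d|/log log|d|)²`. Then `Σ_{N𝔞 ≤ ¼√|d| f(d)} 1/N𝔞 = (π²/6) Σ' (1/a)(1 + O((log log|d|)²/log|d|))`,
where the left hand sum goes over all ideals `𝔞` ∈ `Q(√d)` with norm `≤ ¼√|d| f(d)` and the
constant in the `O`-symbol is effectively computable."
p. 582 (proof of the Corollary): "We can assume `1 − β < (log|d|)⁻²`." — so the Corollary bounds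
EVERY real zero (for the others it is trivial beyond `c(η)`), which is how it is typed.

[Goldfeld1975SiegelZeroClassNumber] p. 611: "For a fundamental discriminant `d`, let
`h(d) = Σ_{a,b,c} 1` denote the number of reduced, primitive, inequivalent binary quadratic forms
`ax² + bxy + cy²` with `d = b² − 4ac`. [...] If, for a real primitive character `χ (mod d)`,
`L(1,χ) ≪ (log|d|)⁻¹`, then `L(s,χ)` will have a real zero `β` in the interval
`0 < 1 − β ≪ (log|d|)⁻¹`. [...] The precise location of this zero can be given as follows.
**THEOREM 1.** Let `d < 0`. If the Siegel zero `β` exists, then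
`1 − β = (6/π²){L(1,χ) + O((1 − β)²(log|d|)³)}{Σ_{a,b,c} 1/a + O(L(1,χ) log|d|)}⁻¹`,
`1 − β = (L(1,χ) + O((1 − β)²(log|d|)³)) L'(1,χ)⁻¹`,
`L'(1,χ) = −(π/√|d|) Σ_{m=1}^{|d|} χ(m) log Γ(m/|d|) + h(d)π(γ + log 2π)/√|d|`,
where `γ` is Euler's constant, and all other constants occurring in the `O`-symbols are effectively
computable." (Theorem 2, `d > 0`, with the continued-fraction quantity `Q`: index only. The third
display — the closed form of `L'(1,χ)` via `log Γ` — is the Lerch/Chowla–Selberg evaluation the tree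
PROVES from `LerchFormula.lean` + `OddCharLogDerivFE.lean`; not re-vendored as a fact.)

## How it is typed

* "`d` fundamental, `χ = (d/·)`" ⟺ "`χ` a primitive quadratic Dirichlet character mod `D = |d|`,
  with `d = −D` if `χ` is odd and `d = D` if `χ` is even" (the tree's dictionary
  `PrimitiveQuadratic.apply_natCast_eq_jacobiSym_neg_of_odd` / `isFundamentalDiscriminant_neg`,
  Montgomery–Vaughan Thm 9.13): `GoldfeldSchinzel1975.signedDisc χ`.
* `Σ' 1/a` of (1)–(2) depends on `d` only: `GoldfeldSchinzel1975.formSum d` = the sum over the pairs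
  `(a, b) ∈ ℕ × ℤ` with `16a² < |d|`, `−a < b ≤ a`, `4a ∣ b² − d` of `1/a` (then `c = (b² − d)/4a`
  is the third coefficient; for fundamental `d` every form of discriminant `d` is primitive).
* "the zero `β` in `(1 − c₁/log|d|, 1)`", `c₁` "an absolute positive constant" from Davenport [1]:
  rendered `∃ c₁ > 0` (any smaller `c₁` keeps Theorem 1 true); "`[1 + O(X) + O(Y)]` with effective
  constants" rendered `|(1 − β) − M| ≤ M · C · (X + Y)`, `M` the main term, one absolute `C`, beyond
  a threshold `D₀` (thresholds and `∃`-constants only weaken the typed statement; below `|d| ≤ 16`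
  the sum `Σ'` is empty and (1) is void).
* Theorem 2: a "class `C`" is rendered by a base form `f₀` (the tree's `Quadratic.BinQF`, primitive,
  `disc f₀ = d`) and its proper-equivalence class (`BinQF.ProperEquiv`, Cox §2.A); the finite sum
  over the forms of `C` in the window `−|a| < b ≤ |a| ≤ ¼√|d|` is rendered as a bound for EVERY
  finite set of such forms; `m₀` = a positive value of `f₀` below all positive values (the least
  positive integer represented — class-invariant); for `d > 0`, `ε₀ = (t₀ + u₀√d)/2` with `(t₀, u₀)`
  the least solution of `t² − d u² = 4` in positive integers (the least totally positive unit `> 1`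
  of `ℚ(√d)`, `d` fundamental).
* Lemma 1: `K` a quadratic field with `d_K = d` (so `K = ℚ(√d)`), the sum over the non-zero ideals
  of `𝓞 K` of norm `≤ ¼√|d| f(d)` (a finite set, `Ideal.finite_setOf_absNorm_le`).
* Goldfeld's Theorem 1: `Σ_{a,b,c} 1/a` over the tree's `BinaryQuadraticForm.reducedForms d`
  (reduced primitive positive definite forms of discriminant `d < 0`, Cox Thm 2.13); the two
  `O`-terms rendered as explicit perturbations `θ₁`, `θ₂`, `θ₃` with `|θ₁|, |θ₃| ≤ C(1−β)² log³|d|`,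
  `|θ₂| ≤ C·L(1,χ) log|d|`; "the Siegel zero" = a real zero with `1 − c₁/log|d| < β < 1`, `∃ c₁ > 0`.

## Contents

* defs `GoldfeldSchinzel1975.signedDisc`, `.formSum`, `.pairCount`;
* NAMED FACTS `goldfeldSchinzel1975_theorem1` (Thm 1 p. 571), `goldfeldSchinzel1975_theorem2_neg`
  (Thm 2, `d < 0`), `goldfeldSchinzel1975_theorem2_pos` (Thm 2, `d > 676`),
  `goldfeldSchinzel1975_corollary` (Corollary p. 572), `goldfeldSchinzel1975_lemma1` (Lemma 1
  p. 572), `goldfeld1975_theorem1` (Goldfeld Thm 1 p. 612, first two displays);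
* PROVED readings: `GoldfeldSchinzel1975.one_sub_ge_of_corollary_odd` / `_even` (the Corollary split
  by parity in the column's `(D, χ)` vocabulary), `GoldfeldSchinzel1975.formSum_nonneg`;
* PROVED (discharge, 2026-08-27): `goldfeldSchinzel1975_theorem2_neg_holds` — Theorem 2 for `d < 0`
  holds as typed: a window form of a positive definite class has `c ≥ 4a`, so `a` is its least
  positive value, taken only at `(±1, 0)`; two properly equivalent window forms coincide
  (`GoldfeldSchinzel1975.eq_of_properEquiv_of_window`), the sum has at most one term, and
  `a ≥ m₀`.
* PROVED (discharges, 2026-08-29, in the theorem-only companion files):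
  `goldfeldSchinzel1975_theorem2_pos_holds` (`SiegelZeroFormSumAsymptoticTheoremTwoPosProofs.lean`:
  Theorem 2 for `d > 676`, by a norm-form/unit-orbit argument giving `Σ 1/|a| ≤ log ε₀/log(½√d − 1)`)
  and `goldfeld1975_theorem1_holds` (`SiegelZeroFormSumAsymptoticGoldfeldProofs.lean`: Goldfeld's
  Theorem 1 by the printed §2 — Kronecker's limit formula summed over the classes, Taylor at `s = 1`).
* PROVED (discharges, 2026-08-29/30, theorem-only companion files):
  `goldfeldSchinzel1975_theorem1_holds` (`SiegelZeroFormSumAsymptoticTheoremOneProofs.lean`),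
  `goldfeldSchinzel1975_lemma1_holds`
  (`SiegelZeroFormSumAsymptoticLemmaOneProofs.lean`) and `goldfeldSchinzel1975_corollary_holds`
  (`SiegelZeroFormSumAsymptoticCorollaryProofs.lean`: the odd half from Theorem 1, `L(1,χ) = πh/√D` and
  `Σ' 1/a ≤ h`; the even half from Theorem 1, `L(1,χ) = 2h_K R_K/√D` and the ideal-side class bound
  `Σ' 1/a ≤ h_K R_K/log(½√D − 1)` of `SiegelZeroFormSumRegulatorBound.lean`). Every named fact of this
  file is now discharged.

LABEL (cell rule): instrument / statement layer. WHAT THIS IS NOT: no claim that any Siegel zero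
exists; the Corollary's constants `6/π`, `6/π²` are superseded in print by Pintz's `12/π`, Schinzel's
`16/π` (typed in `GreatestRealZeroElementary.lean`) and, for odd characters with an explicit threshold,
by Ralaivaosaona–Razakarinoro's `6.035/√d` for `d > 3·10⁸` (`ralaivaosaonaRazakarinoro2026_theorem1`);
nothing here bears on parity. No instances, no notation, no axioms.

## References

* [GoldfeldSchinzel1975] Theorem 1, Theorem 2 (pp. 571–572), Corollary (p. 572), Lemma 1 (p. 572),
  §4 proof of the Corollary (pp. 582–583).
* [Goldfeld1975SiegelZeroClassNumber] §1, Theorem 1 (pp. 611–612).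
* [Cox2013] §2.A (forms, proper equivalence, reduced forms — the tree's `BinQF`, `reducedForms`).
-/

noncomputable section

open Complex Finset
open scoped Classical

namespace Literature.NumberTheory.LFunctions

open Literature.NumberTheory.QuadraticFields.Quadratic
open Literature.NumberTheory.QuadraticFields.BinaryQuadraticForm (reducedForms)

namespace GoldfeldSchinzel1975

/-- The signed fundamental discriminant attached to a primitive quadratic character `χ` mod `D`:
`d = −D` if `χ(−1) = −1`, `d = D` if `χ(−1) = 1` (so that `χ = (d/·)`, Kronecker's symbol).
[cite: GoldfeldSchinzel1975, §1 p. 571] -/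
def signedDisc {D : ℕ} [NeZero D] (χ : DirichletCharacter ℂ D) : ℤ :=
  if χ.Odd then -(D : ℤ) else (D : ℤ)

/-- The number of middle coefficients `b` with `−a < b ≤ a` and `4a ∣ b² − d`, i.e. of quadratic
forms `(a, b, (b² − d)/4a)` of discriminant `d` with leading coefficient `a` in the window (2).
[cite: GoldfeldSchinzel1975, Theorem 1 (2) p. 571] -/
def pairCount (d : ℤ) (a : ℕ) : ℕ :=
  ((Ioc (-(a : ℤ)) (a : ℤ)).filter (fun b => (4 * (a : ℤ)) ∣ b ^ 2 - d)).card

/-- `Σ' 1/a`: the sum of `1/a` over all quadratic forms `(a, b, c)` of discriminant `d` with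
`−a < b ≤ a < ¼√|d|` (condition (2); `a < ¼√|d|` ⟺ `16a² < |d|`).
[cite: GoldfeldSchinzel1975, Theorem 1 (1)–(2) p. 571] -/
def formSum (d : ℤ) : ℝ :=
  ∑ a ∈ (Icc 1 d.natAbs).filter (fun a => 16 * a ^ 2 < d.natAbs), (pairCount d a : ℝ) / (a : ℝ)

/-- `Σ' 1/a ≥ 0`. [cite: GoldfeldSchinzel1975, Theorem 1 (1)–(2) p. 571] -/
theorem formSum_nonneg (d : ℤ) : 0 ≤ formSum d :=
  sum_nonneg fun _ _ => by positivity

end GoldfeldSchinzel1975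

open GoldfeldSchinzel1975

/-! ### Goldfeld–Schinzel, Theorem 1 -/

/-- **Goldfeld–Schinzel 1975, Theorem 1 (NAMED FACT, as printed, p. 571 (1)–(2)).** "Let `d` be
fundamental discriminant, `χ(n) = (d/n)`, `β` the zero of `L(s,χ)` in `(1 − c₁/log|d|, 1)` [...]
`1 − β = (6/π²)(L(1,χ)/Σ' 1/a)[1 + O((log log|d|)²/log|d|) + O((1 − β) log|d|)]`, where `Σ'` is
taken over all quadratic forms `(a,b,c)` of discriminant `d` such that `−a < b ≤ a < ¼√|d|`, and the
constants in the `O`-symbols are effectively computable." Rendered with `∃ c₁ > 0`, one absolute `C`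
and a threshold `D₀`, over primitive quadratic `χ` mod `D = |d|` (`d = signedDisc χ`), `L(1,χ)`
real: with `M = (6/π²) L(1,χ)/Σ' 1/a`,
`|(1 − β) − M| ≤ M·C·((log log D)²/log D + (1 − β) log D)`. PROVED:
`goldfeldSchinzel1975_theorem1_holds` (`SiegelZeroFormSumAsymptoticTheoremOneProofs.lean`; §2 with
Hoffstein's smoothing kernel and Rademacher's convexity bound in place of Lemma 2).
KERNEL COMPANION (one-sided, explicit, case `d < 0`): `ClassSumRepulsion.goldfeldSchinzel_lower_explicit`
(`GoldfeldSchinzelLowerHalfExplicit.lean`) — `(6/π²)·L(1,χ) < (1 − β)(1 + 5(1 − β))·Σ_{Q reduced} 1/a_Q` at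
every real zero `β ∈ [9/10, 1)` (the sum over ALL reduced forms, `⊇` the printed `Σ'`).
[cite: GoldfeldSchinzel1975, Theorem 1 p. 571 (1)–(2)] -/
def goldfeldSchinzel1975_theorem1 : Prop :=
  ∃ c₁ : ℝ, 0 < c₁ ∧ ∃ C : ℝ, ∃ D₀ : ℕ, ∀ (D : ℕ) [NeZero D], D₀ ≤ D →
    ∀ χ : DirichletCharacter ℂ D, χ.IsQuadratic → χ.IsPrimitive →
      ∀ β : ℝ, 1 - c₁ / Real.log D < β → β < 1 → χ.LFunction (β : ℂ) = 0 →
        |(1 - β) - 6 / Real.pi ^ 2 * (χ.LFunction 1).re / formSum (signedDisc χ)| ≤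
          6 / Real.pi ^ 2 * (χ.LFunction 1).re / formSum (signedDisc χ) * C *
            (Real.log (Real.log D) ^ 2 / Real.log D + (1 - β) * Real.log D)

/-! ### Goldfeld–Schinzel, Theorem 2 (the per-class bound on `Σ 1/|a|`) -/

/-- **Goldfeld–Schinzel 1975, Theorem 2, case `d < 0` (NAMED FACT, as printed, pp. 571–572).** "If
`(a, b, c)` runs through a class `C` of properly equivalent primitive forms of discriminant `d`,
supposed fundamental, then `Σ_{(a,b,c) ∈ C, ¼√|d| ≥ |a| ≥ b > −|a|} 1/|a| ≤ 1/m₀` if `d < 0`, where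
`m₀` is the least positive integer represented by `C`." Rendered: `χ` odd primitive quadratic mod `D`
(so `d = −D` is fundamental), `f₀` a primitive form of discriminant `−D` (the class `C` = the forms
properly equivalent to `f₀`, Cox §2.A; positive or negative definite alike, as printed), `m₀ > 0` a
value of `f₀` with no positive value of `f₀` below it; then for every finite set `S` of forms of `C`
in the window `−|a| < b ≤ |a|`, `16a² ≤ D`: `Σ_{f ∈ S} 1/|a_f| ≤ 1/m₀`. Unproved here (§3).
[cite: GoldfeldSchinzel1975, Theorem 2 pp. 571–572 (case d < 0)] -/
def goldfeldSchinzel1975_theorem2_neg : Prop :=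
  ∀ (D : ℕ) [NeZero D], (∃ χ : DirichletCharacter ℂ D, χ.IsQuadratic ∧ χ.IsPrimitive ∧ χ.Odd) →
    ∀ f₀ : BinQF, f₀.IsPrimitive → f₀.disc = -(D : ℤ) →
      ∀ m₀ : ℤ, 0 < m₀ → (∃ x y : ℤ, f₀.eval x y = m₀) →
        (∀ x y : ℤ, 0 < f₀.eval x y → m₀ ≤ f₀.eval x y) →
        ∀ S : Finset BinQF,
          (∀ f ∈ S, f₀.ProperEquiv f ∧ -|f.a| < f.b ∧ f.b ≤ |f.a| ∧ 16 * f.a ^ 2 ≤ (D : ℤ)) →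
            ∑ f ∈ S, (1 : ℝ) / |(f.a : ℝ)| ≤ 1 / (m₀ : ℝ)

/-- **Goldfeld–Schinzel 1975, Theorem 2, case `d > 676` (NAMED FACT, as printed, pp. 571–572).**
"[...] `Σ_{(a,b,c) ∈ C, ¼√d ≥ |a| ≥ b > −|a|} 1/|a| ≤ log ε₀/log(½√d − 1) + 4/√d` if `d > 676`,
where [...] `ε₀` is the least totally positive unit of the field `Q(√d)`." Rendered: `χ` even
primitive quadratic mod `D > 676` (so `d = D` is fundamental), `f₀` primitive of discriminant `D`,
`ε₀ = (t₀ + u₀√D)/2` where `(t₀, u₀)` is a solution of `t² − D u² = 4` in positive integers with `t₀`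
least among all such solutions (the least totally positive unit `> 1` of `ℚ(√D)`); for every finite
set `S` of forms properly equivalent to `f₀` in the window: `Σ_{f ∈ S} 1/|a_f| ≤
log ε₀/log(½√D − 1) + 4/√D`. PROVED: `goldfeldSchinzel1975_theorem2_pos_holds`
(`SiegelZeroFormSumAsymptoticTheoremTwoPosProofs.lean`).
[cite: GoldfeldSchinzel1975, Theorem 2 pp. 571–572 (case d > 676)] -/
def goldfeldSchinzel1975_theorem2_pos : Prop :=
  ∀ (D : ℕ) [NeZero D], 676 < D →
    (∃ χ : DirichletCharacter ℂ D, χ.IsQuadratic ∧ χ.IsPrimitive ∧ χ.Even) →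
    ∀ f₀ : BinQF, f₀.IsPrimitive → f₀.disc = (D : ℤ) →
      ∀ t₀ u₀ : ℕ, 0 < t₀ → 0 < u₀ → (t₀ : ℤ) ^ 2 - D * u₀ ^ 2 = 4 →
        (∀ t u : ℕ, 0 < t → 0 < u → (t : ℤ) ^ 2 - D * u ^ 2 = 4 → t₀ ≤ t) →
        ∀ S : Finset BinQF,
          (∀ f ∈ S, f₀.ProperEquiv f ∧ -|f.a| < f.b ∧ f.b ≤ |f.a| ∧ 16 * f.a ^ 2 ≤ (D : ℤ)) →
            ∑ f ∈ S, (1 : ℝ) / |(f.a : ℝ)| ≤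
              Real.log ((t₀ + u₀ * Real.sqrt D) / 2) / Real.log (Real.sqrt D / 2 - 1) +
                4 / Real.sqrt D

/-! ### Goldfeld–Schinzel, Corollary: `1 − β ≥ (6/π − η)/√|d|`, `(6/π² − η) log d/√d` -/

/-- **Goldfeld–Schinzel 1975, Corollary (NAMED FACT, as printed, p. 572).** "For any `η > 0` and
`|d| > c(η)` (`d` fundamental) we have `1 − β ≥ (6/π − η)(1/√|d|)` if `d < 0`,
`1 − β ≥ (6/π² − η)(log d/√d)` if `d > 0`, where `c(η)` is an effectively computable constant."
Rendered over primitive quadratic `χ` mod `D = |d| > c(η)` (odd ⟺ `d < 0`, even ⟺ `d > 0`) and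
EVERY real `β` with `L(β, χ) = 0` (the proof, p. 582, reduces to `1 − β < (log|d|)⁻²`; for the other
real zeros the bounds are trivial beyond an effective threshold, absorbed into `c(η)`). PROVED:
`goldfeldSchinzel1975_corollary_holds` (`SiegelZeroFormSumAsymptoticCorollaryProofs.lean`, from
`goldfeldSchinzel1975_theorem1_holds`, the class number formulae and, for `d > 0`, the ideal-side form of
Theorem 2 summed over the ideal classes, `GoldfeldSchinzel1975.formSum_le_classNumber_mul_regulator_div`).
[cite: GoldfeldSchinzel1975, Corollary p. 572] -/
def goldfeldSchinzel1975_corollary : Prop :=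
  ∀ η : ℝ, 0 < η → ∃ c : ℕ, ∀ (D : ℕ) [NeZero D], c < D →
    ∀ χ : DirichletCharacter ℂ D, χ.IsQuadratic → χ.IsPrimitive →
      ∀ β : ℝ, χ.LFunction (β : ℂ) = 0 →
        (χ.Odd → (6 / Real.pi - η) / Real.sqrt D ≤ 1 - β) ∧
        (χ.Even → (6 / Real.pi ^ 2 - η) * Real.log D / Real.sqrt D ≤ 1 - β)

/-! ### Goldfeld–Schinzel, Lemma 1: ideals of small norm vs `Σ' 1/a` -/

/-- **Goldfeld–Schinzel 1975, Lemma 1 (NAMED FACT, as printed, p. 572).** "Let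
`f(d) = (log|d|/log log|d|)²`. Then `Σ_{N𝔞 ≤ ¼√|d| f(d)} 1/N𝔞 = (π²/6) Σ' (1/a)(1 + O((log log|d|)²/log|d|))`,
where the left hand sum goes over all ideals `𝔞 ∈ Q(√d)` with norm `≤ ¼√|d| f(d)` and the constant
in the `O`-symbol is effectively computable." Rendered over quadratic fields `K` (`[K:ℚ] = 2`) with
`d = d_K`, `|d_K| ≥ D₀`, the non-zero ideals of `𝓞 K` of norm `≤ ¼√|d| f(d)` (a finite set), one
absolute `C`: `|Σ 1/N𝔞 − (π²/6) Σ'| ≤ (π²/6) Σ' · C (log log|d|)²/log|d|`. PROVED: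
`goldfeldSchinzel1975_lemma1_holds` (`SiegelZeroFormSumAsymptoticLemmaOneProofs.lean`, §2 (3)–(5)).
[cite: GoldfeldSchinzel1975, Lemma 1 p. 572] -/
def goldfeldSchinzel1975_lemma1 : Prop :=
  ∃ C : ℝ, ∃ D₀ : ℕ, ∀ (K : Type) [Field K] [NumberField K], Module.finrank ℚ K = 2 →
    D₀ ≤ (NumberField.discr K).natAbs →
      ∀ S : Finset (Ideal (NumberField.RingOfIntegers K)),
        (∀ I : Ideal (NumberField.RingOfIntegers K), I ∈ S ↔
          I ≠ ⊥ ∧ (Ideal.absNorm I : ℝ) ≤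
            Real.sqrt (NumberField.discr K).natAbs / 4 *
              (Real.log (NumberField.discr K).natAbs /
                Real.log (Real.log (NumberField.discr K).natAbs)) ^ 2) →
        |(∑ I ∈ S, (1 : ℝ) / (Ideal.absNorm I : ℝ)) -
            Real.pi ^ 2 / 6 * formSum (NumberField.discr K)| ≤
          Real.pi ^ 2 / 6 * formSum (NumberField.discr K) * C *
            (Real.log (Real.log (NumberField.discr K).natAbs) ^ 2 /
              Real.log (NumberField.discr K).natAbs)

/-! ### Goldfeld 1975, Theorem 1 (`d < 0`): the two asymptotic identities -/

/-- **Goldfeld 1975, Theorem 1 (NAMED FACT, as printed, p. 612, first two displays).** "Let `d < 0`.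
If the Siegel zero `β` exists, then
`1 − β = (6/π²){L(1,χ) + O((1 − β)²(log|d|)³)}{Σ_{a,b,c} 1/a + O(L(1,χ) log|d|)}⁻¹`,
`1 − β = (L(1,χ) + O((1 − β)²(log|d|)³)) L'(1,χ)⁻¹`, [...] all other constants occurring in the
`O`-symbols are effectively computable." Here `h(d) = Σ_{a,b,c} 1` counts the reduced primitive
forms of discriminant `d` (p. 611), so `Σ_{a,b,c} 1/a` runs over the tree's `reducedForms d`; "the
Siegel zero" = the real zero with `0 < 1 − β ≪ (log|d|)⁻¹` (p. 611), rendered `∃ c₁ > 0`,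
`1 − c₁/log|d| < β < 1`; the `O`-terms are explicit perturbations bounded by one absolute `C`, beyond
a threshold `D₀`; `χ` = the odd primitive quadratic character mod `D = |d|`. (The third display, the
`log Γ` closed form of `L'(1,χ)`, is Lerch's formula — proved in the tree, not re-vendored.) PROVED:
`goldfeld1975_theorem1_holds` (`SiegelZeroFormSumAsymptoticGoldfeldProofs.lean`, by the printed §2).
[cite: Goldfeld1975SiegelZeroClassNumber, Theorem 1 p. 612] -/
def goldfeld1975_theorem1 : Prop :=
  ∃ c₁ : ℝ, 0 < c₁ ∧ ∃ C : ℝ, ∃ D₀ : ℕ, ∀ (D : ℕ) [NeZero D], D₀ ≤ D →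
    ∀ χ : DirichletCharacter ℂ D, χ.IsQuadratic → χ.IsPrimitive → χ.Odd →
      ∀ β : ℝ, 1 - c₁ / Real.log D < β → β < 1 → χ.LFunction (β : ℂ) = 0 →
        (∃ θ₁ θ₂ : ℝ, |θ₁| ≤ C * (1 - β) ^ 2 * Real.log D ^ 3 ∧
            |θ₂| ≤ C * (χ.LFunction 1).re * Real.log D ∧
            1 - β = 6 / Real.pi ^ 2 * ((χ.LFunction 1).re + θ₁) /
              ((∑ Q ∈ reducedForms (-(D : ℤ)), (1 : ℝ) / (Q.1 : ℝ)) + θ₂)) ∧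
        (∃ θ₃ : ℝ, |θ₃| ≤ C * (1 - β) ^ 2 * Real.log D ^ 3 ∧
            1 - β = ((χ.LFunction 1).re + θ₃) / (deriv χ.LFunction 1).re)

/-! ### PROVED readings in the column's vocabulary -/

namespace GoldfeldSchinzel1975

/-- **The Corollary for odd characters**: for `η > 0` there is an effective `c(η)` with
`(6/π − η)/√D ≤ 1 − β` for every odd primitive quadratic `χ` mod `D > c(η)` and every real zero `β`
of `L(s, χ)` (imaginary quadratic side, `d = −D`). [cite: GoldfeldSchinzel1975, Corollary p. 572] -/
theorem one_sub_ge_of_corollary_odd (h : goldfeldSchinzel1975_corollary) {η : ℝ} (hη : 0 < η) :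
    ∃ c : ℕ, ∀ (D : ℕ) [NeZero D], c < D → ∀ χ : DirichletCharacter ℂ D, χ.IsQuadratic →
      χ.IsPrimitive → χ.Odd → ∀ β : ℝ, χ.LFunction (β : ℂ) = 0 →
        (6 / Real.pi - η) / Real.sqrt D ≤ 1 - β := by
  obtain ⟨c, hc⟩ := h η hη
  exact ⟨c, fun D _ hD χ hquad hprim hodd β hz => (hc D hD χ hquad hprim β hz).1 hodd⟩

/-- **The Corollary for even characters**: for `η > 0` there is an effective `c(η)` with
`(6/π² − η) log D/√D ≤ 1 − β` for every even primitive quadratic `χ` mod `D > c(η)` and every real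
zero `β` of `L(s, χ)` (real quadratic side, `d = D`; note `L(0, χ) = 0` for even `χ`, consistent
since `(6/π²) log D/√D < 1`). [cite: GoldfeldSchinzel1975, Corollary p. 572] -/
theorem one_sub_ge_of_corollary_even (h : goldfeldSchinzel1975_corollary) {η : ℝ} (hη : 0 < η) :
    ∃ c : ℕ, ∀ (D : ℕ) [NeZero D], c < D → ∀ χ : DirichletCharacter ℂ D, χ.IsQuadratic →
      χ.IsPrimitive → χ.Even → ∀ β : ℝ, χ.LFunction (β : ℂ) = 0 →
        (6 / Real.pi ^ 2 - η) * Real.log D / Real.sqrt D ≤ 1 - β := by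
  obtain ⟨c, hc⟩ := h η hη
  exact ⟨c, fun D _ hD χ hquad hprim heven β hz => (hc D hD χ hquad hprim β hz).2 heven⟩

/-- `signedDisc` of an odd character is `−D`. [cite: GoldfeldSchinzel1975, §1 p. 571] -/
theorem signedDisc_of_odd {D : ℕ} [NeZero D] {χ : DirichletCharacter ℂ D} (h : χ.Odd) :
    signedDisc χ = -(D : ℤ) := by
  simp [signedDisc, h]

/-- `signedDisc` of an even character mod `D ≠ 1… ` — precisely: if `χ` is not odd, `signedDisc χ = D`.
[cite: GoldfeldSchinzel1975, §1 p. 571] -/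
theorem signedDisc_of_not_odd {D : ℕ} [NeZero D] {χ : DirichletCharacter ℂ D} (h : ¬ χ.Odd) :
    signedDisc χ = (D : ℤ) := by
  simp [signedDisc, h]

end GoldfeldSchinzel1975

/-! ### Goldfeld–Schinzel, Theorem 2 for `d < 0` — PROVED

The window `−|a| < b ≤ |a| ≤ ¼√|d|` (i.e. `16a² ≤ |d|`) of Theorem 2 is so narrow that, for a
positive definite class, it contains AT MOST ONE form: `4ac = b² + |d| ≥ 16a²` gives `c ≥ 4a`, so
`4a·f(x,y) = (2ax + by)² + |d|y² ≥ |d| ≥ 16a²` for `y ≠ 0` — the value `a = f(±1, 0)` is the least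
positive value of `f` and is taken nowhere else. Two properly equivalent window forms therefore have
the same `a`, the matrix carrying one to the other fixes `(±1, 0)` up to sign, i.e. is `±(1 k; 0 1)`,
and `b′ = b + 2ak` with `b, b′ ∈ (−a, a]` forces `k = 0`. Hence the sum of Theorem 2 has at most one
term `1/a`, and `a`, a positive value of the class, is `≥ m₀`. This is the printed proof (§3,
p. 577: "For `d < 0` it is enough to prove that every class contains at most one form satisfying (10).
Now, since [`4ac = b² − d ≥ 16a²`] we infer from (10) that [`c > a`] thus every form satisfying (10) is
reduced, and it is well known that every class contains at most one such form."), with the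
uniqueness of the reduced form in a class (Cox Thm. 2.8, not in the tree) replaced by the direct
argument above for window forms, which needs only the tree's `BinQF` algebra. A negative definite `f₀` represents no positive integer, so the
hypothesis on `m₀` is then void. -/

namespace GoldfeldSchinzel1975

/-- In the window `16a² ≤ D` a form of discriminant `−D` with `a > 0` takes values `≥ 4a` off the
axis `y = 0`: `4a·f(x, y) = (2ax + by)² + D y² ≥ D ≥ 16a²`. [cite: GoldfeldSchinzel1975, §3 p. 577] -/
theorem four_mul_a_le_eval_of_window {D : ℤ} {f : BinQF} (ha : 0 < f.a) (hdisc : f.disc = -D)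
    (hwin : 16 * f.a ^ 2 ≤ D) {x y : ℤ} (hy : y ≠ 0) : 4 * f.a ≤ f.eval x y := by
  have key := f.four_mul_a_mul_eval x y
  rw [hdisc] at key
  have hy2 : 1 ≤ y ^ 2 := by
    have : 0 < y ^ 2 := by positivity
    omega
  have hD0 : 0 ≤ D := le_trans (by positivity) hwin
  -- `4a·f ≥ D y² ≥ D ≥ 16 a²`, divide by `4a > 0`
  have h1 : 16 * f.a ^ 2 ≤ 4 * f.a * f.eval x y := by
    nlinarith [sq_nonneg (2 * f.a * x + f.b * y), mul_le_mul_of_nonneg_left hy2 hD0]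
  nlinarith

/-- In the window `16a² ≤ D`, `a` is a lower bound for every value of a form of discriminant `−D`
with `a > 0` at a non-zero vector. [cite: GoldfeldSchinzel1975, §3 p. 577] -/
theorem a_le_eval_of_window {D : ℤ} {f : BinQF} (ha : 0 < f.a) (hdisc : f.disc = -D)
    (hwin : 16 * f.a ^ 2 ≤ D) {x y : ℤ} (hxy : x ≠ 0 ∨ y ≠ 0) : f.a ≤ f.eval x y := by
  by_cases hy : y = 0
  · subst hy
    have hx : x ≠ 0 := by simpa using hxy
    have hx2 : 1 ≤ x ^ 2 := by
      have : 0 < x ^ 2 := by positivity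
      omega
    have : f.eval x 0 = f.a * x ^ 2 := by simp [BinQF.eval]
    rw [this]
    nlinarith
  · have h := four_mul_a_le_eval_of_window ha hdisc hwin (x := x) hy
    linarith

/-- In the window `16a² ≤ D`, the value `a` of a form of discriminant `−D` with `a > 0` is taken only
at `(±1, 0)`: `f(p, r) = a` forces `r = 0` and `p² = 1`. [cite: GoldfeldSchinzel1975, §3 p. 577] -/
theorem eq_axis_of_eval_eq_a {D : ℤ} {f : BinQF} (ha : 0 < f.a) (hdisc : f.disc = -D)
    (hwin : 16 * f.a ^ 2 ≤ D) {p r : ℤ} (h : f.eval p r = f.a) : r = 0 ∧ p ^ 2 = 1 := by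
  have hr : r = 0 := by
    by_contra hr
    have h4 := four_mul_a_le_eval_of_window ha hdisc hwin (x := p) hr
    linarith
  subst hr
  refine ⟨rfl, ?_⟩
  have : f.eval p 0 = f.a * p ^ 2 := by simp [BinQF.eval]
  rw [this] at h
  have hp : f.a * (p ^ 2 - 1) = 0 := by linarith
  rcases mul_eq_zero.mp hp with h0 | h0
  · linarith
  · linarith

/-- **Two properly equivalent forms in the window coincide**: for forms `f ~ g` of discriminant `−D`
with `a > 0`, `−a < b ≤ a` and `16a² ≤ D` (both), `f = g`. (Both are reduced — `c ≥ 4a > a` — and a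
class has one reduced form; proved directly: the matrix is `±(1 k; 0 1)` and `b′ = b + 2ak`.)
[cite: GoldfeldSchinzel1975, §3 p. 577] [cite: Cox2013, Thm. 2.8] -/
theorem eq_of_properEquiv_of_window {D : ℤ} {f g : BinQF} (hfa : 0 < f.a) (hfdisc : f.disc = -D)
    (hfb1 : -f.a < f.b) (hfb2 : f.b ≤ f.a) (hfwin : 16 * f.a ^ 2 ≤ D)
    (hga : 0 < g.a) (hgdisc : g.disc = -D) (hgb1 : -g.a < g.b) (hgb2 : g.b ≤ g.a)
    (hgwin : 16 * g.a ^ 2 ≤ D) (h : f.ProperEquiv g) : f = g := by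
  obtain ⟨p, q, r, s, hdet, rfl⟩ := h
  -- the leading coefficients agree
  have hpr : p ≠ 0 ∨ r ≠ 0 := by
    by_contra hcon
    push Not at hcon
    obtain ⟨rfl, rfl⟩ := hcon
    simp at hdet
  have hsr : s ≠ 0 ∨ -r ≠ 0 := by
    by_contra hcon
    push Not at hcon
    obtain ⟨rfl, hr⟩ := hcon
    have : r = 0 := by linarith
    subst this
    simp at hdet
  have h1 : f.a ≤ (f.act p q r s).a := by
    rw [BinQF.a_act]
    exact a_le_eval_of_window hfa hfdisc hfwin hpr
  have h2 : (f.act p q r s).a ≤ f.a := by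
    have hle := a_le_eval_of_window hga hgdisc hgwin hsr (x := s) (y := -r)
    rw [← (f.act p q r s).a_act s (-q) (-r) p, f.act_act_inv hdet] at hle
    exact hle
  have heq : (f.act p q r s).a = f.a := le_antisymm h2 h1
  -- hence `r = 0`, `p = ±1`, `s = p`
  have hpr' := eq_axis_of_eval_eq_a hfa hfdisc hfwin (p := p) (r := r) (by rwa [BinQF.a_act] at heq)
  obtain ⟨hr0, hp2⟩ := hpr'
  subst hr0
  have hps : p * s = 1 := by linarith
  -- `b' = b + 2a·(pq)` lies in `(−a, a]` together with `b`: `pq = 0`, so `q = 0`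
  have hb' : (f.act p q 0 s).b = f.b + 2 * f.a * (p * q) := by
    simp only [BinQF.act]
    linear_combination f.b * hps
  have hga' : (f.act p q 0 s).a = f.a := heq
  rw [hga'] at hgb1 hgb2
  rw [hb'] at hgb1 hgb2
  have hk : p * q = 0 := by
    rcases lt_trichotomy (p * q) 0 with hk | hk | hk
    · nlinarith
    · exact hk
    · nlinarith
  have hp0 : p ≠ 0 := by
    rintro rfl
    simp at hp2
  have hq0 : q = 0 := by
    rcases mul_eq_zero.mp hk with h | h
    · exact absurd h hp0
    · exact h
  subst hq0
  -- `s = p` and `p² = 1`: the matrix is `±1`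
  have hp1 : p = 1 ∨ p = -1 := by
    have : (p - 1) * (p + 1) = 0 := by ring_nf; linarith
    rcases mul_eq_zero.mp this with h | h
    · left; linarith
    · right; linarith
  have hsp : s = p := by rcases hp1 with rfl | rfl <;> linarith
  subst hsp
  rcases hp1 with rfl | rfl <;> ext <;> simp [BinQF.act]

end GoldfeldSchinzel1975

open GoldfeldSchinzel1975 in
/-- **Goldfeld–Schinzel 1975, Theorem 2, case `d < 0` — PROVED (discharge of the named fact
`goldfeldSchinzel1975_theorem2_neg`, exactly as typed).** The class of a negative definite `f₀`
represents no positive integer (the hypothesis on `m₀` is void); for a positive definite class the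
window contains at most one form (`eq_of_properEquiv_of_window`), whose `a = f₀(p, r) > 0` is a value
of the class, so `1/a ≤ 1/m₀`. [cite: GoldfeldSchinzel1975, Theorem 2 pp. 571–572 (case d < 0), proof §3 p. 577] -/
theorem goldfeldSchinzel1975_theorem2_neg_holds : goldfeldSchinzel1975_theorem2_neg := by
  intro D _ _ f₀ hprim hdisc m₀ hm₀ hrep hmin S hS
  obtain ⟨x₀, y₀, hrep⟩ := hrep
  have hD0 : (0 : ℤ) < D := by
    have : 0 < D := Nat.pos_of_ne_zero (NeZero.ne D)
    exact_mod_cast this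
  have ha0 : f₀.a ≠ 0 := by
    intro h0
    have : f₀.disc = f₀.b ^ 2 := by simp [BinQF.disc, h0]
    rw [hdisc] at this
    nlinarith [sq_nonneg f₀.b]
  rcases lt_or_gt_of_ne ha0 with hneg | hpos
  · -- negative definite: `f₀` takes no positive value, contradicting `f₀(x₀, y₀) = m₀ > 0`
    exfalso
    set g : BinQF := ⟨-f₀.a, -f₀.b, -f₀.c⟩ with hg
    have hgeval : ∀ x y, g.eval x y = -f₀.eval x y := fun x y => by
      simp only [BinQF.eval, hg]; ring
    have hgdisc : g.disc < 0 := by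
      have : g.disc = f₀.disc := by simp only [BinQF.disc, hg]; ring
      rw [this, hdisc]; linarith
    by_cases hxy : x₀ = 0 ∧ y₀ = 0
    · obtain ⟨rfl, rfl⟩ := hxy
      simp [BinQF.eval] at hrep
      linarith
    · have hxy' : x₀ ≠ 0 ∨ y₀ ≠ 0 := by tauto
      have hga : 0 < g.a := by simp only [hg]; linarith
      have := g.eval_pos hga hgdisc hxy'
      rw [hgeval] at this
      linarith
  · -- positive definite class
    have hpp : f₀.IsPosPrim (-(D : ℤ)) := ⟨hdisc, hpos, hprim⟩
    have hneg : (-(D : ℤ)) < 0 := by linarith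
    have hSpos : ∀ f ∈ S, 0 < f.a ∧ f.disc = -(D : ℤ) ∧ -f.a < f.b ∧ f.b ≤ f.a ∧
        16 * f.a ^ 2 ≤ (D : ℤ) := by
      intro f hf
      obtain ⟨hequiv, hb1, hb2, hwin⟩ := hS f hf
      have hfp : f.IsPosPrim (-(D : ℤ)) := hequiv.isPosPrim hneg hpp
      have hfa : 0 < f.a := hfp.a_pos
      refine ⟨hfa, hfp.disc_eq, ?_, ?_, hwin⟩
      · rwa [abs_of_pos hfa] at hb1
      · rwa [abs_of_pos hfa] at hb2
    rcases S.eq_empty_or_nonempty with hE | ⟨f, hf⟩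
    · rw [hE, Finset.sum_empty]
      positivity
    · obtain ⟨hfa, hfdisc, hfb1, hfb2, hfwin⟩ := hSpos f hf
      have hsub : S ⊆ {f} := by
        intro g hg
        obtain ⟨hga, hgdisc, hgb1, hgb2, hgwin⟩ := hSpos g hg
        rw [Finset.mem_singleton]
        have hfg : f.ProperEquiv g := (hS f hf).1.symm.trans (hS g hg).1
        exact (eq_of_properEquiv_of_window hfa hfdisc hfb1 hfb2 hfwin hga hgdisc hgb1 hgb2 hgwin
          hfg).symm
      -- `m₀ ≤ a_f`: `a_f = f₀(p, r) > 0` is a value of `f₀`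
      have hm : m₀ ≤ f.a := by
        obtain ⟨p, q', r, s, -, hfeq⟩ := (hS f hf).1
        have hfa' : f.a = f₀.eval p r := by rw [hfeq]; rfl
        rw [hfa'] at hfa ⊢
        exact hmin p r hfa
      calc ∑ g ∈ S, (1 : ℝ) / |(g.a : ℝ)|
          ≤ ∑ g ∈ ({f} : Finset BinQF), (1 : ℝ) / |(g.a : ℝ)| :=
            Finset.sum_le_sum_of_subset_of_nonneg hsub fun _ _ _ => by positivity
        _ = 1 / (f.a : ℝ) := by
            rw [Finset.sum_singleton, abs_of_pos (by exact_mod_cast hfa)]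
        _ ≤ 1 / (m₀ : ℝ) :=
            one_div_le_one_div_of_le (by exact_mod_cast hm₀) (by exact_mod_cast hm)

end Literature.NumberTheory.LFunctions

end
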